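import Mathlib
import Summits.Ventures.PercRepro2.TypedRulesSt

/-!
# Connectivity and the state through a hat (blind cell PercRepro2, p2 g0, 2026-08-25; sub-claim
S1; the lead's ruling 04:33:25Z (1) «p2 takes (A): the TypedStar rule», mine-1's MINE1-J1.md §23.9)

A **hat** is an unmarked vertex `u` whose typed edges are exactly `e_v = u–v`, `e₁ = u–a₁`,
`e₂ = u–a₂` (`v ≠ a₁, a₂`), every other edge at `u` pinned closed. In a copy, `u` connects the ends
of its open edges: a copy carrying `e₁` and `e₂` joins the roots, a copy carrying `e_v, e₁` sees the
edge `v–a₁`, one carrying `e_v, e₂` sees `v–a₂`, any other copy sees nothing. This file holds the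
graph side of the hat rule (`TypedHat.lean`):

* **`hatEnds`** — the graph with `u` removed: `e_v` re-mapped to `v–a₁`, `e₁` to `v–a₂`;
* **`seenA` / `seenB`** — what a copy sees of the hat, as Booleans (a killed copy sees both);
* **`hatCoef`** — the coefficient table of the rule (a placement count, checked in Python:
  `mining/p2/g0/hat_coef.py`);
* **`conn_hat_iff`** — connectivity among the vertices other than `u` is that of the re-mapped
  configuration (when the copy is not killed);
* **`st_hat`** — hence the state agrees; **`st_q'_of_hat_both`**, **`st_q'_of_hatEnds_both`** — a
  killed copy has the roots joined, on both sides.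

Own code; standard axioms.
-/

namespace Summit.Ventures.PercRepro2

open UnionCluster

namespace CovForm

namespace TypedRed

open OneTyped

/-! ## The re-mapped graph, what a copy sees, the coefficient table -/

section Defs

variable {V : Type*} {E : Type*} [DecidableEq E]

/-- The graph with the hat removed: `e_v` becomes `v–a₁`, `e₁` becomes `v–a₂`. -/
def hatEnds (ends : E → Sym2 V) (e_v e₁ : E) (v a₁ a₂ : V) : E → Sym2 V :=
  Function.update (Function.update ends e_v s(v, a₁)) e₁ s(v, a₂)

/-- A copy carrying `e_v, e₁` (or killed) sees `v–a₁`. -/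
def seenA (a a' a'' : Bool) : Bool := (a' && a'') || (a && a')

/-- A copy carrying `e_v, e₂` (or killed) sees `v–a₂`. -/
def seenB (a a' a'' : Bool) : Bool := (a' && a'') || (a && a'')

/-- The hat coefficients `hatCoef τv τ₁ τ₂ t₁ t₂`: the number of placements of the hat's edges
(types `τv, τ₁, τ₂`) producing a fixed live pattern with `t₁` copies seeing `v–a₁` and `t₂` seeing
`v–a₂`. -/
def hatCoef (τv τ₁ τ₂ t₁ t₂ : ℕ) : ℕ :=
  if τv = 1 ∧ τ₁ = 1 ∧ τ₂ = 1 then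
    (if t₁ = 1 ∧ t₂ = 0 then 2 else if t₁ = 0 ∧ t₂ = 1 then 2 else if t₁ = 0 ∧ t₂ = 0 then 6 else 0)
  else if τv = 1 ∧ τ₁ = 1 ∧ τ₂ = 2 then
    (if t₁ = 1 ∧ t₂ = 0 then 1 else if t₁ = 0 ∧ t₂ = 1 then 2 else 0)
  else if τv = 1 ∧ τ₁ = 2 ∧ τ₂ = 1 then
    (if t₁ = 1 ∧ t₂ = 0 then 2 else if t₁ = 0 ∧ t₂ = 1 then 1 else 0)
  else if τv = 2 ∧ τ₁ = 1 ∧ τ₂ = 1 then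
    (if t₁ = 1 ∧ t₂ = 0 then 2 else if t₁ = 0 ∧ t₂ = 1 then 2 else if t₁ = 1 ∧ t₂ = 1 then 1 else 0)
  else if τv = 2 ∧ τ₁ = 1 ∧ τ₂ = 2 then
    (if t₁ = 0 ∧ t₂ = 2 then 1 else if t₁ = 1 ∧ t₂ = 1 then 1 else 0)
  else if τv = 2 ∧ τ₁ = 2 ∧ τ₂ = 1 then
    (if t₁ = 2 ∧ t₂ = 0 then 1 else if t₁ = 1 ∧ t₂ = 1 then 1 else 0)
  else 0

variable {ends : E → Sym2 V} {e_v e₁ : E} {v a₁ a₂ : V}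

/-- The re-mapped `e_v` is `v–a₁`. -/
lemma hatEnds_ev (h : e_v ≠ e₁) : hatEnds ends e_v e₁ v a₁ a₂ e_v = s(v, a₁) := by
  unfold hatEnds
  rw [Function.update_of_ne h, Function.update_self]

/-- The re-mapped `e₁` is `v–a₂`. -/
lemma hatEnds_e1 : hatEnds ends e_v e₁ v a₁ a₂ e₁ = s(v, a₂) := by
  unfold hatEnds
  rw [Function.update_self]

/-- Every other edge is unchanged. -/
lemma hatEnds_other {e : E} (h1 : e ≠ e_v) (h2 : e ≠ e₁) :
    hatEnds ends e_v e₁ v a₁ a₂ e = ends e := by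
  unfold hatEnds
  rw [Function.update_of_ne h2, Function.update_of_ne h1]

end Defs

/-! ## Connectivity through a hat -/

section Conn

variable {V : Type*} {E : Type*} [DecidableEq E]
variable {ends : E → Sym2 V} {u v a₁ a₂ : V} {e_v e₁ e₂ : E}

/-- **Connectivity through a hat.** Let `x` open the hat's edges `e_v, e₁, e₂` as `a, a', a''`
(not both `e₁, e₂`) and nothing else at `u`; let `x'` agree with `x` off the hat's edges, open
`e_v` (now `v–a₁`) iff `a ∧ a'`, `e₁` (now `v–a₂`) iff `a ∧ a''`, and close `e₂`. Then two vertices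
other than `u` are connected in `x` iff they are connected in the re-mapped `x'`. -/
theorem conn_hat_iff (hv : ends e_v = s(u, v)) (h1 : ends e₁ = s(u, a₁)) (h2 : ends e₂ = s(u, a₂))
    (hv1 : e_v ≠ e₁) (hv2 : e_v ≠ e₂) (h12 : e₁ ≠ e₂) {x x' : Config E} {a a' a'' : Bool}
    (hxv : x e_v = a) (hx1 : x e₁ = a') (hx2 : x e₂ = a'') (hx'v : x' e_v = (a && a'))
    (hx'1 : x' e₁ = (a && a'')) (hx'2 : x' e₂ = false)
    (hagree : ∀ e, e ≠ e_v → e ≠ e₁ → e ≠ e₂ → x' e = x e)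
    (hclosed : ∀ e, u ∈ ends e → e ≠ e_v → e ≠ e₁ → e ≠ e₂ → x e = false)
    (hnk : ¬ (a' = true ∧ a'' = true)) {p q : V} (hp : p ≠ u) (hq : q ≠ u) :
    Conn ends x p q ↔ Conn (hatEnds ends e_v e₁ v a₁ a₂) x' p q := by
  set ends' := hatEnds ends e_v e₁ v a₁ a₂ with hends'
  -- an open edge at `u` is one of the three
  have hmem : ∀ g, x g = true → u ∈ ends g → g = e_v ∨ g = e₁ ∨ g = e₂ := by
    intro g hg hug
    by_cases hgv : g = e_v
    · exact Or.inl hgv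
    by_cases hg1 : g = e₁
    · exact Or.inr (Or.inl hg1)
    by_cases hg2 : g = e₂
    · exact Or.inr (Or.inr hg2)
    exact absurd hg (by rw [hclosed g hug hgv hg1 hg2]; exact Bool.false_ne_true)
  -- the re-mapped edges connect `v` to the root the hat joined it with
  have hconnA : a = true → a' = true → Conn ends' x' v a₁ := fun ha ha' =>
    conn_of_openAdj ⟨e_v, by rw [hx'v, ha, ha']; rfl, hatEnds_ev hv1⟩
  have hconnB : a = true → a'' = true → Conn ends' x' v a₂ := fun ha ha'' =>
    conn_of_openAdj ⟨e₁, by rw [hx'1, ha, ha'']; rfl, hatEnds_e1⟩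
  constructor
  · intro h
    let S : Set V := {q | (q ≠ u ∧ Conn ends' x' p q) ∨
      (q = u ∧ ∀ n, n ≠ u → OpenAdj ends x u n → Conn ends' x' p n)}
    have hS : ∀ s ∈ S, ∀ t, (openGraph ends x).Adj s t → t ∈ S := by
      intro s hs t hst
      obtain ⟨hne, e, he, hends⟩ := openGraph_adj.1 hst
      rcases hs with ⟨hsu, hconn⟩ | ⟨hsu, hall⟩
      · by_cases htu : t = u
        · rw [htu] at hends
          refine Or.inr ⟨htu, fun n hnu hn => ?_⟩
          obtain ⟨e', he', hends'⟩ := hn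
          -- `e` joins `s` to `u`, `e'` joins `u` to `n`: both are hat edges
          have hue : u ∈ ends e := by rw [hends]; exact Sym2.mem_mk_right _ _
          have hue' : u ∈ ends e' := by rw [hends']; exact Sym2.mem_mk_left _ _
          -- what the hat edges say about their other ends
          have hsv : e = e_v → s = v := fun hev => by
            rw [hev, hv] at hends
            rcases Sym2.eq_iff.1 hends with ⟨h₁, _⟩ | ⟨_, h₂⟩
            · exact absurd h₁.symm hsu
            · exact h₂.symm
          have hs1 : e = e₁ → s = a₁ := fun he1 => by
            rw [he1, h1] at hends
            rcases Sym2.eq_iff.1 hends with ⟨h₁, _⟩ | ⟨_, h₂⟩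
            · exact absurd h₁.symm hsu
            · exact h₂.symm
          have hs2 : e = e₂ → s = a₂ := fun he2 => by
            rw [he2, h2] at hends
            rcases Sym2.eq_iff.1 hends with ⟨h₁, _⟩ | ⟨_, h₂⟩
            · exact absurd h₁.symm hsu
            · exact h₂.symm
          have hnv : e' = e_v → n = v := fun hev => by
            rw [hev, hv] at hends'
            rcases Sym2.eq_iff.1 hends' with ⟨_, h₂⟩ | ⟨h₁, _⟩
            · exact h₂.symm
            · exact absurd h₁.symm hnu
          have hn1 : e' = e₁ → n = a₁ := fun he1 => by
            rw [he1, h1] at hends'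
            rcases Sym2.eq_iff.1 hends' with ⟨_, h₂⟩ | ⟨h₁, _⟩
            · exact h₂.symm
            · exact absurd h₁.symm hnu
          have hn2 : e' = e₂ → n = a₂ := fun he2 => by
            rw [he2, h2] at hends'
            rcases Sym2.eq_iff.1 hends' with ⟨_, h₂⟩ | ⟨h₁, _⟩
            · exact h₂.symm
            · exact absurd h₁.symm hnu
          -- the open values
          have hav : e = e_v → a = true := fun hev => by rw [← hxv, ← hev]; exact he
          have ha1 : e = e₁ → a' = true := fun he1 => by rw [← hx1, ← he1]; exact he
          have ha2 : e = e₂ → a'' = true := fun he2 => by rw [← hx2, ← he2]; exact he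
          have hav' : e' = e_v → a = true := fun hev => by rw [← hxv, ← hev]; exact he'
          have ha1' : e' = e₁ → a' = true := fun he1 => by rw [← hx1, ← he1]; exact he'
          have ha2' : e' = e₂ → a'' = true := fun he2 => by rw [← hx2, ← he2]; exact he'
          rcases hmem e he hue with hev | he1 | he2 <;> rcases hmem e' he' hue' with hev' | he1' | he2'
          · rw [hnv hev', ← hsv hev]; exact hconn
          · rw [hn1 he1']; exact conn_trans (hsv hev ▸ hconn) (hconnA (hav hev) (ha1' he1'))
          · rw [hn2 he2']; exact conn_trans (hsv hev ▸ hconn) (hconnB (hav hev) (ha2' he2'))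
          · rw [hnv hev']; exact conn_trans (hs1 he1 ▸ hconn) (conn_symm (hconnA (hav' hev') (ha1 he1)))
          · rw [hn1 he1', ← hs1 he1]; exact hconn
          · exact absurd ⟨ha1 he1, ha2' he2'⟩ hnk
          · rw [hnv hev']; exact conn_trans (hs2 he2 ▸ hconn) (conn_symm (hconnB (hav' hev') (ha2 he2)))
          · exact absurd ⟨ha1' he1', ha2 he2⟩ hnk
          · rw [hn2 he2', ← hs2 he2]; exact hconn
        · -- an edge not at `u` is untouched
          have hev : e ≠ e_v := fun hev => by
            have : u ∈ ends e := by rw [hev, hv]; exact Sym2.mem_mk_left _ _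
            rw [hends] at this
            rcases Sym2.mem_iff.1 this with h' | h'
            · exact hsu h'.symm
            · exact htu h'.symm
          have he1 : e ≠ e₁ := fun he1 => by
            have : u ∈ ends e := by rw [he1, h1]; exact Sym2.mem_mk_left _ _
            rw [hends] at this
            rcases Sym2.mem_iff.1 this with h' | h'
            · exact hsu h'.symm
            · exact htu h'.symm
          have he2 : e ≠ e₂ := fun he2 => by
            have : u ∈ ends e := by rw [he2, h2]; exact Sym2.mem_mk_left _ _
            rw [hends] at this
            rcases Sym2.mem_iff.1 this with h' | h'
            · exact hsu h'.symm
            · exact htu h'.symm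
          refine Or.inl ⟨htu, conn_trans hconn (conn_of_openAdj ⟨e, ?_, ?_⟩)⟩
          · rw [hagree e hev he1 he2]; exact he
          · rw [hends', hatEnds_other hev he1]; exact hends
      · subst hsu
        have htu : t ≠ s := fun h' => hne h'.symm
        exact Or.inl ⟨htu, hall t htu ⟨e, he, hends⟩⟩
    have hpS : p ∈ S := Or.inl ⟨hp, conn_refl _ _ _⟩
    rcases mem_of_conn_of_closed hS hpS h with ⟨_, hc⟩ | ⟨hqu, _⟩
    · exact hc
    · exact absurd hqu hq
  · intro h
    let S : Set V := {q | Conn ends x p q}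
    have hS : ∀ s ∈ S, ∀ t, (openGraph ends' x').Adj s t → t ∈ S := by
      intro s hs t hst
      obtain ⟨_, e, he, hends⟩ := openGraph_adj.1 hst
      by_cases hev : e = e_v
      · subst hev
        rw [hx'v] at he
        rw [hends', hatEnds_ev hv1] at hends
        have ha : a = true := (Bool.and_eq_true_iff.1 he).1
        have ha' : a' = true := (Bool.and_eq_true_iff.1 he).2
        have hva : Conn ends x v a₁ :=
          conn_trans (conn_of_openAdj ⟨e, by rw [hxv, ha], by rw [hv, Sym2.eq_swap]⟩)
            (conn_of_openAdj ⟨e₁, by rw [hx1, ha'], h1⟩)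
        rcases Sym2.eq_iff.1 hends with ⟨rfl, rfl⟩ | ⟨rfl, rfl⟩
        · exact conn_trans hs hva
        · exact conn_trans hs (conn_symm hva)
      by_cases he1 : e = e₁
      · subst he1
        rw [hx'1] at he
        rw [hends', hatEnds_e1] at hends
        have ha : a = true := (Bool.and_eq_true_iff.1 he).1
        have ha'' : a'' = true := (Bool.and_eq_true_iff.1 he).2
        have hva : Conn ends x v a₂ :=
          conn_trans (conn_of_openAdj ⟨e_v, by rw [hxv, ha], by rw [hv, Sym2.eq_swap]⟩)
            (conn_of_openAdj ⟨e₂, by rw [hx2, ha''], h2⟩)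
        rcases Sym2.eq_iff.1 hends with ⟨rfl, rfl⟩ | ⟨rfl, rfl⟩
        · exact conn_trans hs hva
        · exact conn_trans hs (conn_symm hva)
      by_cases he2 : e = e₂
      · subst he2
        rw [hx'2] at he
        exact absurd he Bool.false_ne_true
      rw [hagree e hev he1 he2] at he
      rw [hends', hatEnds_other hev he1] at hends
      exact conn_trans hs (conn_of_openAdj ⟨e, he, hends⟩)
    exact mem_of_conn_of_closed hS (conn_refl _ _ _) h

end Conn

/-! ## What a copy sees, as Booleans -/

section Seen

/-- A killed copy sees `v–a₁`. -/
lemma seenA_of_both {a a' a'' : Bool} (h : a' = true ∧ a'' = true) : seenA a a' a'' = true := by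
  rcases h with ⟨rfl, rfl⟩; cases a <;> rfl

/-- A killed copy sees `v–a₂`. -/
lemma seenB_of_both {a a' a'' : Bool} (h : a' = true ∧ a'' = true) : seenB a a' a'' = true := by
  rcases h with ⟨rfl, rfl⟩; cases a <;> rfl

/-- A live copy sees `v–a₁` iff it carries `e_v` and `e₁`. -/
lemma seenA_of_not_both {a a' a'' : Bool} (h : ¬ (a' = true ∧ a'' = true)) :
    seenA a a' a'' = (a && a') := by
  cases a <;> cases a' <;> cases a'' <;> simp_all [seenA]

/-- A live copy sees `v–a₂` iff it carries `e_v` and `e₂`. -/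
lemma seenB_of_not_both {a a' a'' : Bool} (h : ¬ (a' = true ∧ a'' = true)) :
    seenB a a' a'' = (a && a'') := by
  cases a <;> cases a' <;> cases a'' <;> simp_all [seenB]

end Seen

/-! ## The state through a hat -/

section State

open Classical

variable {V : Type*} {E : Type*} [DecidableEq E]
variable (ends : E → Sym2 V) (o a₁ a₂ a₃ b : V)

/-- The state of `x` is the state of the re-mapped `x'` (the hat not killed). -/
theorem st_hat {u v : V} {e_v e₁ e₂ : E} (hv : ends e_v = s(u, v)) (h1 : ends e₁ = s(u, a₁))
    (h2 : ends e₂ = s(u, a₂)) (hv1 : e_v ≠ e₁) (hv2 : e_v ≠ e₂) (h12 : e₁ ≠ e₂)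
    (huo : u ≠ o) (hu1 : u ≠ a₁) (hu2 : u ≠ a₂) (hu3 : u ≠ a₃) (hub : u ≠ b)
    (x x' : Config E) {a a' a'' : Bool}
    (hxv : x e_v = a) (hx1 : x e₁ = a') (hx2 : x e₂ = a'') (hx'v : x' e_v = (a && a'))
    (hx'1 : x' e₁ = (a && a'')) (hx'2 : x' e₂ = false)
    (hagree : ∀ e, e ≠ e_v → e ≠ e₁ → e ≠ e₂ → x' e = x e)
    (hclosed : ∀ e, u ∈ ends e → e ≠ e_v → e ≠ e₁ → e ≠ e₂ → x e = false)
    (hnk : ¬ (a' = true ∧ a'' = true)) :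
    st ends o a₁ a₂ a₃ b x = st (hatEnds ends e_v e₁ v a₁ a₂) o a₁ a₂ a₃ b x' := by
  have key : ∀ {p q : V}, p ≠ u → q ≠ u →
      (Conn ends x p q ↔ Conn (hatEnds ends e_v e₁ v a₁ a₂) x' p q) := fun hp hq =>
    conn_hat_iff hv h1 h2 hv1 hv2 h12 hxv hx1 hx2 hx'v hx'1 hx'2 hagree hclosed hnk hp hq
  unfold st
  simp only [Prod.mk.injEq]
  exact ⟨decide_eq_decide.mpr (key hu2.symm hu1.symm), decide_eq_decide.mpr (key hu1.symm huo.symm),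
    decide_eq_decide.mpr (key hu2.symm huo.symm), decide_eq_decide.mpr (key hu1.symm hub.symm),
    decide_eq_decide.mpr (key hu2.symm hub.symm), decide_eq_decide.mpr (key hu1.symm hu3.symm),
    decide_eq_decide.mpr (key hu2.symm hu3.symm)⟩

omit [DecidableEq E] in
/-- A copy carrying both root edges of the hat joins the roots. -/
theorem st_q'_of_hat_both {u : V} {e₁ e₂ : E} (h1 : ends e₁ = s(u, a₁)) (h2 : ends e₂ = s(u, a₂))
    {x : Config E} (hx1 : x e₁ = true) (hx2 : x e₂ = true) : (st ends o a₁ a₂ a₃ b x).q' = true := by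
  show decide (Conn ends x a₂ a₁) = true
  exact decide_eq_true (conn_trans (conn_of_openAdj ⟨e₂, hx2, by rw [h2, Sym2.eq_swap]⟩)
    (conn_of_openAdj ⟨e₁, hx1, h1⟩))

/-- A copy carrying both re-mapped edges joins the roots through `v`. -/
theorem st_q'_of_hatEnds_both {v : V} {e_v e₁ : E} (hv1 : e_v ≠ e₁) {x' : Config E}
    (hx'v : x' e_v = true) (hx'1 : x' e₁ = true) :
    (st (hatEnds ends e_v e₁ v a₁ a₂) o a₁ a₂ a₃ b x').q' = true := by
  show decide (Conn (hatEnds ends e_v e₁ v a₁ a₂) x' a₂ a₁) = true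
  exact decide_eq_true (conn_trans (conn_of_openAdj ⟨e₁, hx'1, by rw [hatEnds_e1, Sym2.eq_swap]⟩)
    (conn_of_openAdj ⟨e_v, hx'v, hatEnds_ev hv1⟩))

end State

end TypedRed

end CovForm

end Summit.Ventures.PercRepro2
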